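import Mathlib
import Summits.ABC.ABC.Statement
import HarnessLib

/-!
# The odd-prime-exponent corner of shape D forces a Mersenne prime (solo-blind seat, session 5)

Shape D of the first open support is `1 + p^m = 2^k q^n` (`p, q` odd primes, `m ≥ 2`).  For `m = ℓ` an odd prime we
show, by lifting the exponent, that `q ∤ p + 1`; hence `p + 1` is a power of two — `p` is a Mersenne prime — and
`(p^ℓ + 1)/(p + 1) = q^n` is a Nagell–Ljunggren equation at the negative base `-p`.  The cofactor
`Ψ = (p^ℓ + 1)/(p + 1)` is handled through the sign-free identity `Ψ = (p - 1)·p·(1 + p² + ⋯ + p^(ℓ-3)) + 1`, which also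
shows that it is odd.  Companion of `SoloBlindFermatCorner`.

* `mersenne_prime_corner` : `p ^ ℓ + 1 = 2 ^ k * q ^ n` (`p, q, ℓ` odd primes) implies `¬ q ∣ p + 1` and
  `∃ s, p + 1 = 2 ^ s`.
-/

namespace Summit.ABC.ABC.Theorems

/-- **Mersenne-prime corner.** If `p, q, ℓ` are odd primes and `p^ℓ + 1 = 2^k q^n`, then `q ∤ p + 1`, so `p + 1` is a
power of two. -/
theorem mersenne_prime_corner {k n ℓ p q : ℕ} (hp : p.Prime) (hq : q.Prime) (hℓ : ℓ.Prime) (hp2 : p ≠ 2)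
    (hq2 : q ≠ 2) (hℓ2 : ℓ ≠ 2) (h : p ^ ℓ + 1 = 2 ^ k * q ^ n) :
    ¬ q ∣ p + 1 ∧ ∃ s : ℕ, p + 1 = 2 ^ s := by
  haveI := Fact.mk hq
  have hp3 : 3 ≤ p := by have := hp.two_le; omega
  have hq3 : 3 ≤ q := by have := hq.two_le; omega
  have hℓodd : Odd ℓ := hℓ.odd_of_ne_two hℓ2
  obtain ⟨h', hℓh⟩ : ∃ h', ℓ = 2 * h' + 1 := hℓodd
  have hh1 : 1 ≤ h' := by have := hℓ.two_le; omega
  -- `S = 1 + p² + ⋯ + (p²)^(h'-1)`, `(p² - 1) S = p^(2h') - 1`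
  set S := ∑ i ∈ Finset.range h', (p ^ 2) ^ i with hSdef
  have hp2le : 2 ≤ p ^ 2 := by nlinarith
  have hgeom : S = ((p ^ 2) ^ h' - 1) / (p ^ 2 - 1) := Nat.geomSum_eq hp2le h'
  have hS : (p ^ 2 - 1) * S = (p ^ 2) ^ h' - 1 := by
    rw [hgeom, Nat.mul_div_cancel' (Nat.sub_one_dvd_pow_sub_one (p ^ 2) h')]
  have hS1 : 1 ≤ S := by
    have : ∑ i ∈ Finset.range 1, (p ^ 2) ^ i ≤ S :=
      Finset.sum_le_sum_of_subset (Finset.range_subset_range.mpr hh1)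
    simpa using this
  -- the cofactor `Ψ = (p-1) p S + 1` with `(p+1) Ψ = p^ℓ + 1`
  set Ψ := (p - 1) * p * S + 1 with hΨdef
  have hΨ : (p + 1) * Ψ = 2 ^ k * q ^ n := by
    rw [← h, hℓh, hΨdef]
    have h1 : 1 ≤ (p ^ 2) ^ h' := Nat.one_le_pow _ _ (by positivity)
    have h2 : 1 ≤ p ^ 2 := by omega
    have h3 : 1 ≤ p := by omega
    zify [h1, h2, h3] at hS ⊢
    linear_combination (p : ℤ) * hS
  have hΨodd : Ψ % 2 = 1 := by
    have h2 : 2 ∣ (p - 1) * p * S := by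
      have : 2 ∣ p - 1 := by
        have := Nat.odd_iff.mp (hp.odd_of_ne_two hp2)
        omega
      exact (this.mul_right p).mul_right S
    omega
  have hΨbig : p + 2 ≤ Ψ := by
    have h6 : (p - 1) * p * 1 ≤ (p - 1) * p * S := Nat.mul_le_mul_left _ hS1
    rw [mul_one] at h6
    have h5 : p + 1 ≤ (p - 1) * p := by
      obtain ⟨t, rfl⟩ : ∃ t, p = t + 1 := ⟨p - 1, by omega⟩
      rw [Nat.add_sub_cancel]
      nlinarith
    omega
  have hΨ0 : Ψ ≠ 0 := by omega
  -- every prime factor of `Ψ` is `q`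
  have hΨsupp : ∀ d : ℕ, d.Prime → d ∣ Ψ → d = q := by
    intro d hd hdΨ
    have : d ∣ 2 ^ k * q ^ n := hΨ ▸ hdΨ.mul_left (p + 1)
    rcases (Nat.Prime.dvd_mul hd).mp this with h2 | hqn
    · have := (Nat.prime_dvd_prime_iff_eq hd Nat.prime_two).mp (hd.dvd_of_dvd_pow h2)
      subst this
      exfalso
      omega
    · exact (Nat.prime_dvd_prime_iff_eq hd hq).mp (hd.dvd_of_dvd_pow hqn)
  have hnot : ¬ q ∣ p + 1 := by
    intro hqp
    have hqnp : ¬ q ∣ p := by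
      intro h'
      have := (Nat.prime_dvd_prime_iff_eq hq hp).mp h'
      subst this
      have : q ∣ 1 := (Nat.dvd_add_right (dvd_refl q)).mp hqp
      exact hq.one_lt.ne' (Nat.dvd_one.mp this)
    -- LTE: `v_q(p^ℓ + 1) = v_q(p + 1) + v_q(ℓ)`
    have hlte := padicValNat.pow_add_pow (hq.odd_of_ne_two hq2) (x := p) (y := 1) (by simpa using hqp) hqnp (hℓ.odd_of_ne_two hℓ2)
    rw [one_pow, h] at hlte
    have hv2 : padicValNat q (2 ^ k) = 0 := by
      apply padicValNat.eq_zero_of_not_dvd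
      intro h'
      have := (Nat.prime_dvd_prime_iff_eq hq Nat.prime_two).mp (hq.dvd_of_dvd_pow h')
      omega
    have hvn : padicValNat q (2 ^ k * q ^ n) = n := by
      rw [padicValNat.mul (by positivity) (by positivity), hv2, padicValNat.prime_pow, zero_add]
    have hvℓ : padicValNat q ℓ ≤ 1 := by
      by_cases hql : q = ℓ
      · subst hql; rw [padicValNat_self]
      · rw [padicValNat.eq_zero_of_not_dvd]
        · exact zero_le_one
        · intro h'; exact hql ((Nat.prime_dvd_prime_iff_eq hq hℓ).mp h')
    have hvprod : padicValNat q (p + 1) + padicValNat q Ψ = n := by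
      rw [← padicValNat.mul (by omega) hΨ0, hΨ, hvn]
    obtain ⟨j, hj⟩ : ∃ j, Ψ = q ^ j := ⟨_, Nat.eq_prime_pow_of_unique_prime_dvd hΨ0 (hΨsupp _)⟩
    have hjv : padicValNat q Ψ = j := by rw [hj, padicValNat.prime_pow]
    have hj1 : j ≤ 1 := by omega
    have hΨle : Ψ ≤ q := by
      rw [hj]
      calc q ^ j ≤ q ^ 1 := Nat.pow_le_pow_right hq.pos hj1
        _ = q := pow_one q
    have hqle : q ≤ p + 1 := Nat.le_of_dvd (by omega) hqp
    omega
  refine ⟨hnot, ?_⟩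
  have hp1supp : ∀ d : ℕ, d.Prime → d ∣ p + 1 → d = 2 := by
    intro d hd hdp
    have : d ∣ 2 ^ k * q ^ n := hΨ ▸ hdp.mul_right Ψ
    rcases (Nat.Prime.dvd_mul hd).mp this with h2 | hqn
    · exact (Nat.prime_dvd_prime_iff_eq hd Nat.prime_two).mp (hd.dvd_of_dvd_pow h2)
    · have := (Nat.prime_dvd_prime_iff_eq hd hq).mp (hd.dvd_of_dvd_pow hqn)
      subst this
      exact absurd hdp hnot
  exact ⟨_, Nat.eq_prime_pow_of_unique_prime_dvd (by omega) (hp1supp _)⟩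

end Summit.ABC.ABC.Theorems
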